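import Summits.ResolutionOfSingularities.ResolutionOfSingularities.Theorems.FrobeniusLadderFInjectiveMacaulayficationOmegaOneS2ChartData
import Summits.ResolutionOfSingularities.ResolutionOfSingularities.Theorems.FrobeniusLadderFInjectiveMacaulayficationOmegaOneS2ClassRow
import Summits.ResolutionOfSingularities.ResolutionOfSingularities.Theorems.FrobeniusLadderFInjectiveMacaulayficationPencilChartPackage
import Summits.ResolutionOfSingularities.ResolutionOfSingularities.Theorems.FrobeniusLadderFInjectiveMacaulayficationChartPrincipalIdeal
import Summits.ResolutionOfSingularities.ResolutionOfSingularities.Theorems.FrobeniusLadderFInjectiveMacaulayficationOmegaCureCentreFactors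
import Summits.ResolutionOfSingularities.ResolutionOfSingularities.Theorems.FrobeniusLadderFInjectiveMacaulayficationB9Specimen
import HarnessLib

/-!
# Ω₁ GLOBAL PATCH, F6: the 1223 charts of `X̃₂ = Bl_{K″} X_{B9}` as `Spec k[y]/(g_c)`, the chart ideal `ȳ^G·(ȳ^{M₁}, ȳ^{M₂}(ȳ^r − ȳ^s))` of the centre `(L + (ḡ))·𝒪_{X̃₂}`,
# `L·𝒪_{X̃₂}` invertible, and the cure morphism `τ₂ : Bl_{(L³+(ḡ)L²)K″} X → X̃₂` (a blowing up along `(L + (ḡ))·𝒪_{X̃₂}`)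
# (BED Ω₁ GLOBAL PATCH, F6 v2 (D) assembly, part 1; crux `FInjectiveMacaulayfication` stmt-ResolutionOfSingularities-15315, chain w45a; seat res-L1-w45a-stub-3 g15)

[OURS · L1 W4.5a] Support file (`--supports stmt-ResolutionOfSingularities-15315 --as helper`); theorems only; assembly of ✓ bricks; no named fact; NOT a statement of any manuscript; nothing of the
crux is proved. AI-written (AI review is weaker than expert review).
`f = f_B9 = X₄² + X₀⁹ + X₁⁹ + X₂⁹ + X₃⁹`, `3 ≠ 0` in `k`; `K″ = (x^e : e ∈ genSet 5 AL2)` (Σ₂ tables, ✓ `OmegaOneS2KNewtonKFan`), `L = (x^e : e ∈ genSet 5 B9NewtonKFan.AL2)` (the class centre), `ḡ = X₀X₂² − X₁³`.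
* `irrelevant_le_radical_K2` — the 1223 vertex charts cover `X̃₂`; `isIntegral_K2`; ★ `exists_chart_package` — for every chart `c`: the section-ring isomorphism `Φ_c : Γ(X̃₂, U_c) ≅ k[y]/(g_c)`
  with its pull formula, `g_c(0) ≠ 0`, `θ_{V_c} f = y^{V_c u₀}·g_c`, `Γ(X̃₂, U_c)` a domain.
* ★ `isEffectiveCartier_L_K2` — `L·𝒪_{X̃₂}` is an effective Cartier divisor (✓ `ChartPrincipalIdeal.exists_generator_of_chart'` + ✓ `OmegaOneS2ChartData.hgeB`);
  ★★ `exists_tau2` — the cure morphism `τ₂` IS a blowing up of `X̃₂` along `(L + (ḡ))·𝒪_{X̃₂}` (✓ `OmegaCureCentreFactors.exists_cure_fac_of_isEffectiveCartier`).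
* ★ `ideal_centre_chart_eq` — on `U_c`: `((L + (ḡ))·𝒪_{X̃₂})(U_c) = (γ·u, γ·v)` with `γ = Φ_c⁻¹ȳ^G`, `u = Φ_c⁻¹ȳ^{M₁}`, `v = Φ_c⁻¹(ȳ^{M₂}(ȳ^r − ȳ^s))`, the exponents read off `C = V_c·m_L(parent c)`,
  `A = V_c·P`, `B = V_c·Q` (`m = min(A,B)`, `G = min(C,m)`, `M₁ = C − G`, `M₂ = m − G`, `r = A − m`, `s = B − m`).
[cite: StacksProject, Tag 0804, Tag 080A; GortzWedhorn2020, (13.19); CoxLittleSchenck2011, §2.3, §11.1]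
-/

set_option linter.dupNamespace false
set_option linter.style.longLine false

noncomputable section

namespace Summit.ResolutionOfSingularities.ResolutionOfSingularities.Theorems.FInjectiveMacaulayfication.OmegaOneS2PencilCharts

open AlgebraicGeometry CategoryTheory MvPolynomial Literature.AlgebraicGeometry.Resolution
open Summit.ResolutionOfSingularities.ResolutionOfSingularities.Theorems.FInjectiveMacaulayfication
open SliceableCentre FanCheckKit FanCheckSound OmegaOneGlobalCureFanCert OmegaOneS2KNewtonKFan OmegaOneS2ChartData

/-! ## §1 The charts of `X̃₂` -/

/-- **The 1223 vertex charts cover `X̃₂`** (radical form; verbatim adaptation of ✓ `OmegaOneFloorCM.irrelevant_le_radical_b9`, `t = 1223`). [bookkeeping] -/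
theorem irrelevant_le_radical_K2 (k : Type) [Field k] (F : Ideal (MvPolynomial (Fin 5) k)) :
    (HomogeneousIdeal.irrelevant (reesGrading (Ideal.span ((fun e : Fin 5 →₀ ℕ => Ideal.Quotient.mk F (monomial e (1 : k))) '' (genSet 5 AL2 : Set (Fin 5 →₀ ℕ)))))).toIdeal ≤
      (Ideal.span (Set.range fun c : Fin 1223 => reesT (I := Ideal.span ((fun e : Fin 5 →₀ ℕ => Ideal.Quotient.mk F (monomial e (1 : k))) '' (genSet 5 AL2 : Set (Fin 5 →₀ ℕ))))
        (Ideal.Quotient.mk F (monomial (chartM 5 AL2 CL 1223 c) (1 : k))) (hv k F c))).radical := by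
  have hImap : Ideal.span ((fun e : Fin 5 →₀ ℕ => Ideal.Quotient.mk F (monomial e (1 : k))) '' (genSet 5 AL2 : Set (Fin 5 →₀ ℕ))) =
      (Ideal.span ((fun b : Fin 5 →₀ ℕ => (monomial b (1 : k) : MvPolynomial (Fin 5) k)) '' (genSet 5 AL2 : Set (Fin 5 →₀ ℕ)))).map (Ideal.Quotient.mk F) := by
    rw [Ideal.map_span, Set.image_image]
  refine ReesCoverOfPowers.stub_reesCoverOfPowers _ _ (Ideal.Quotient.mk F '' ((fun b : Fin 5 →₀ ℕ => (monomial b (1 : k) : MvPolynomial (Fin 5) k)) '' (genSet 5 AL2 : Set (Fin 5 →₀ ℕ))))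
    (by rw [hImap, Ideal.map_span]) 1223 _ (hv k F) ?_
  rintro _ ⟨_, ⟨a', ha', rfl⟩, rfl⟩
  obtain ⟨c, K, hK, y, hy, hEq⟩ := hcov k a' ha'
  refine ⟨c, K, hK, Ideal.Quotient.mk F y, ?_, ?_⟩
  · rw [hImap, ← Ideal.map_pow]
    exact Ideal.mem_map_of_mem _ hy
  · rw [← map_pow, hEq, map_mul]

/-- `K″ ≠ ⊥` modulo the prime `(f)` and `X̃₂` is integral. [bookkeeping] -/
theorem isIntegral_K2 (k : Type) [Field k] (h3 : (3 : k) ≠ 0) (f : MvPolynomial (Fin 5) k) (hf : f = X 4 ^ 2 + X 0 ^ 9 + X 1 ^ 9 + X 2 ^ 9 + X 3 ^ 9) :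
    IsIntegral (affineBlowup (Ideal.span ((fun e : Fin 5 →₀ ℕ => Ideal.Quotient.mk (Ideal.span {f}) (monomial e (1 : k))) '' (genSet 5 AL2 : Set (Fin 5 →₀ ℕ))))) := by
  classical
  haveI hpr : (Ideal.span {f}).IsPrime := (Ideal.span_singleton_prime (B9Specimen.prime_f k h3 f hf).ne_zero).mpr (B9Specimen.prime_f k h3 f hf)
  haveI : IsDomain (MvPolynomial (Fin 5) k ⧸ Ideal.span {f}) := Ideal.Quotient.isDomain _
  have hXne := B9Specimen.mk_X_ne_zero k h3 f hf
  have hm0 : Ideal.Quotient.mk (Ideal.span {f}) (monomial (chartM 5 AL2 CL 1223 0) (1 : k)) ≠ 0 := by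
    rw [monomial_eq, C_1, one_mul, Finsupp.prod, map_prod]
    exact Finset.prod_ne_zero_iff.mpr fun j _ => by rw [map_pow]; exact pow_ne_zero _ (hXne j)
  exact affineBlowup.isIntegral fun h0 => hm0 (by rw [← Ideal.mem_bot, ← h0]; exact hv k _ 0)

/-- ★ **THE CHART PACKAGE OF `X̃₂`**: for every chart `c` of Σ₂ a strict transform `g_c` with `g_c(0) ≠ 0`, `θ_{V_c} f = y^{V_c u₀}·g_c`, and the
section-ring isomorphism `Φ_c : Γ(X̃₂, U_c) ≅ k[y]/(g_c)` with its pull formula (`g_c` divisible by no variable). [OURS · assembly; cite: StacksProject, Tag 0804; CoxLittleSchenck2011, §2.3] -/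
theorem exists_chart_package (k : Type) [Field k] (h3 : (3 : k) ≠ 0) (f : MvPolynomial (Fin 5) k) (hf : f = X 4 ^ 2 + X 0 ^ 9 + X 1 ^ 9 + X 2 ^ 9 + X 3 ^ 9) (c : Fin 1223) :
    ∃ g : MvPolynomial (Fin 5) k, constantCoeff g ≠ 0 ∧ (∀ i : Fin 5, ¬ (X i ∣ g)) ∧
      aeval (fun j : Fin 5 => ∏ i : Fin 5, (X i : MvPolynomial (Fin 5) k) ^ Vq c i j) f = monomial (Finsupp.equivFunOnFinite.symm ((Vq c).mulVec (U0 c))) 1 * g ∧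
      ∃ Φ : Γ(affineBlowup (Ideal.span ((fun e : Fin 5 →₀ ℕ => Ideal.Quotient.mk (Ideal.span {f}) (monomial e (1 : k))) '' (genSet 5 AL2 : Set (Fin 5 →₀ ℕ)))),
          affineBlowup.chartOpen (Ideal.Quotient.mk (Ideal.span {f}) (monomial (chartM 5 AL2 CL 1223 c) (1 : k))) (hv k _ c)) ≃+* (MvPolynomial (Fin 5) k ⧸ Ideal.span {g}),
        ∀ q : MvPolynomial (Fin 5) k,
          Φ (affineBlowup.pull (Ideal.span ((fun e : Fin 5 →₀ ℕ => Ideal.Quotient.mk (Ideal.span {f}) (monomial e (1 : k))) '' (genSet 5 AL2 : Set (Fin 5 →₀ ℕ))))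
              (affineBlowup.chartOpen (Ideal.Quotient.mk (Ideal.span {f}) (monomial (chartM 5 AL2 CL 1223 c) (1 : k))) (hv k _ c)) (Ideal.Quotient.mk (Ideal.span {f}) q)) =
            Ideal.Quotient.mk (Ideal.span {g}) (aeval (fun j : Fin 5 => ∏ i : Fin 5, (X i : MvPolynomial (Fin 5) k) ^ Vq c i j) q) := by
  obtain ⟨g, hθ, hg0⟩ := OmegaOneS2ClassRow.exists_refining_strictTransform k f hf c
  have hθ' : aeval (fun j : Fin 5 => ∏ i : Fin 5, (X i : MvPolynomial (Fin 5) k) ^ Vq c i j) f = monomial (Finsupp.equivFunOnFinite.symm ((Vq c).mulVec (U0 c))) 1 * g := by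
    rw [hθ, coe_u0]
  have hcop : ∀ i : Fin 5, ¬ (X i ∣ g) := fun i => PencilQuotFinSucc.not_X_dvd_of_constantCoeff_ne_zero hg0 i
  haveI hpr : (Ideal.span {f}).IsPrime := (Ideal.span_singleton_prime (B9Specimen.prime_f k h3 f hf).ne_zero).mpr (B9Specimen.prime_f k h3 f hf)
  have hXne := B9Specimen.mk_X_ne_zero k h3 f hf
  obtain ⟨Φ, hΦ⟩ := PencilChartPackage.exists_sections_ringEquiv_of_isPrime f (Vq c) (hV c) (chartM 5 AL2 CL 1223 c) (chartA 5 AL2 CL 1223 c) (hgen c) (genSet 5 AL2) (haA c) (hge c)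
    _ g hθ hpr hXne hcop (hv k _ c)
  exact ⟨g, hg0, hcop, hθ', Φ, hΦ⟩

/-! ## §2 `L·𝒪_{X̃₂}` is invertible; the cure morphism `τ₂` -/

/-- ★ **`L·𝒪_{X̃₂}` IS AN EFFECTIVE CARTIER DIVISOR** (`L` the class centre of B9, `X̃₂ = Bl_{K″} X`). [OURS · assembly; cite: GortzWedhorn2020, (13.19); CoxLittleSchenck2011, §11.1] -/
theorem isEffectiveCartier_L_K2 (k : Type) [Field k] (h3 : (3 : k) ≠ 0) (f : MvPolynomial (Fin 5) k) (hf : f = X 4 ^ 2 + X 0 ^ 9 + X 1 ^ 9 + X 2 ^ 9 + X 3 ^ 9) :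
    IsEffectiveCartier ((affineBlowup.idealSheaf (Ideal.span ((fun e : Fin 5 →₀ ℕ => Ideal.Quotient.mk (Ideal.span {f}) (monomial e (1 : k))) '' (genSet 5 B9NewtonKFan.AL2 : Set (Fin 5 →₀ ℕ))))).comap
      (affineBlowup.π (Ideal.span ((fun e : Fin 5 →₀ ℕ => Ideal.Quotient.mk (Ideal.span {f}) (monomial e (1 : k))) '' (genSet 5 AL2 : Set (Fin 5 →₀ ℕ)))))) := by
  intro x
  haveI := isIntegral_K2 k h3 f hf
  obtain ⟨c, hc⟩ := MonomialChartSections.exists_mem_chartOpen (fun c : Fin 1223 => Ideal.Quotient.mk (Ideal.span {f}) (monomial (chartM 5 AL2 CL 1223 c) (1 : k)))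
    (hv k (Ideal.span {f})) (irrelevant_le_radical_K2 k _) x
  obtain ⟨g, hg0, hcop, hθ, Φ, hΦ⟩ := exists_chart_package k h3 f hf c
  haveI : IsDomain Γ(affineBlowup (Ideal.span ((fun e : Fin 5 →₀ ℕ => Ideal.Quotient.mk (Ideal.span {f}) (monomial e (1 : k))) '' (genSet 5 AL2 : Set (Fin 5 →₀ ℕ)))),
      (affineBlowup.chartOpen (Ideal.Quotient.mk (Ideal.span {f}) (monomial (chartM 5 AL2 CL 1223 c) (1 : k))) (hv k _ c) :
        (affineBlowup (Ideal.span ((fun e : Fin 5 →₀ ℕ => Ideal.Quotient.mk (Ideal.span {f}) (monomial e (1 : k))) '' (genSet 5 AL2 : Set (Fin 5 →₀ ℕ))))).Opens)) :=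
    @IsIntegral.component_integral _ inferInstance _ ⟨⟨x, hc⟩⟩
  -- `g_c` is not a unit: `k[y]/(g_c) ≅ Γ(X̃₂, U_c)` is a domain, hence nontrivial
  have hunit : ¬ IsUnit g := by
    intro hu
    haveI : Nontrivial (MvPolynomial (Fin 5) k ⧸ Ideal.span {g}) := Φ.symm.toRingHom.domain_nontrivial
    exact (Ideal.Quotient.nontrivial_iff.mp ‹_›) ((Ideal.span_singleton_eq_top).mpr hu)
  obtain ⟨γ, hγ, hI⟩ := ChartPrincipalIdeal.exists_generator_of_chart' f (Vq c) (chartM 5 AL2 CL 1223 c) (genSet 5 AL2) g (hv k _ c) hg0 hunit Φ hΦ (genSet 5 B9NewtonKFan.AL2)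
    (chartM 5 B9NewtonKFan.AL2 B9NewtonKFan.CL 25 ⟨getL PARENT_S2 c 0, (parent_lt c).1⟩) (B9NewtonKFan.hm _) (hgeB c)
  exact ⟨_, hc, γ, hγ, hI⟩

/-- ★★ **THE CURE MORPHISM**: `Bl_{(L³+(ḡ)L²)·K″} X → X̃₂ = Bl_{K″} X` exists and IS a blowing up along `(L + (ḡ))·𝒪_{X̃₂}`, over `X`. [OURS · assembly; cite: StacksProject, Tag 080A] -/
theorem exists_tau2 (k : Type) [Field k] (h3 : (3 : k) ≠ 0) (f : MvPolynomial (Fin 5) k) (hf : f = X 4 ^ 2 + X 0 ^ 9 + X 1 ^ 9 + X 2 ^ 9 + X 3 ^ 9) (g₀ : MvPolynomial (Fin 5) k ⧸ Ideal.span {f}) :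
    ∃ τ : affineBlowup ((Ideal.span ((fun e : Fin 5 →₀ ℕ => Ideal.Quotient.mk (Ideal.span {f}) (monomial e (1 : k))) '' (genSet 5 B9NewtonKFan.AL2 : Set (Fin 5 →₀ ℕ))) ^ 3 +
          Ideal.span {g₀} * Ideal.span ((fun e : Fin 5 →₀ ℕ => Ideal.Quotient.mk (Ideal.span {f}) (monomial e (1 : k))) '' (genSet 5 B9NewtonKFan.AL2 : Set (Fin 5 →₀ ℕ))) ^ 2) *
          Ideal.span ((fun e : Fin 5 →₀ ℕ => Ideal.Quotient.mk (Ideal.span {f}) (monomial e (1 : k))) '' (genSet 5 AL2 : Set (Fin 5 →₀ ℕ)))) ⟶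
        affineBlowup (Ideal.span ((fun e : Fin 5 →₀ ℕ => Ideal.Quotient.mk (Ideal.span {f}) (monomial e (1 : k))) '' (genSet 5 AL2 : Set (Fin 5 →₀ ℕ)))),
      IsBlowup τ ((affineBlowup.idealSheaf (Ideal.span ((fun e : Fin 5 →₀ ℕ => Ideal.Quotient.mk (Ideal.span {f}) (monomial e (1 : k))) '' (genSet 5 B9NewtonKFan.AL2 : Set (Fin 5 →₀ ℕ))) +
          Ideal.span {g₀})).comap (affineBlowup.π (Ideal.span ((fun e : Fin 5 →₀ ℕ => Ideal.Quotient.mk (Ideal.span {f}) (monomial e (1 : k))) '' (genSet 5 AL2 : Set (Fin 5 →₀ ℕ)))))) ∧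
      τ ≫ affineBlowup.π (Ideal.span ((fun e : Fin 5 →₀ ℕ => Ideal.Quotient.mk (Ideal.span {f}) (monomial e (1 : k))) '' (genSet 5 AL2 : Set (Fin 5 →₀ ℕ)))) =
        affineBlowup.π _ :=
  OmegaCureCentreFactors.exists_cure_fac_of_isEffectiveCartier
    (Ideal.span ((fun e : Fin 5 →₀ ℕ => Ideal.Quotient.mk (Ideal.span {f}) (monomial e (1 : k))) '' (genSet 5 B9NewtonKFan.AL2 : Set (Fin 5 →₀ ℕ))))
    (Ideal.span ((fun e : Fin 5 →₀ ℕ => Ideal.Quotient.mk (Ideal.span {f}) (monomial e (1 : k))) '' (genSet 5 AL2 : Set (Fin 5 →₀ ℕ)))) g₀ (isEffectiveCartier_L_K2 k h3 f hf)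

/-! ## §3 The chart ideal of the centre `(L + (ḡ))·𝒪_{X̃₂}` -/

set_option maxHeartbeats 1600000 in
-- the chart-formula rewrite elaborates the full centre twice (as in ✓ `PencilChartPackage.ideal_chart_eq`)
/-- ★ **THE CENTRE ON A CHART OF `X̃₂`**: with the exponent bookkeeping of ✓ `OmegaOneS2ChartData` (`C = V_c·m_L(parent c) = G + M₁`, `θ_{V_c} ḡ = y^G·χ`, `χ = y^{M₂}(y^r − y^s)`),
`((L + (ḡ))·𝒪_{X̃₂})(U_c) = (Φ_c⁻¹ȳ^G · Φ_c⁻¹ȳ^{M₁}, Φ_c⁻¹ȳ^G · Φ_c⁻¹χ̄)`. (The proof of ✓ `PencilChartPackage.ideal_chart_eq` with the centre's own monomial data.) [OURS · assembly; cite: GortzWedhorn2020, (13.19)] -/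
theorem ideal_centre_chart_eq {k : Type} [Field k] {n : ℕ} (f : MvPolynomial (Fin n) k) (V : Matrix (Fin n) (Fin n) ℕ) (m : Fin n →₀ ℕ) (A : Finset (Fin n →₀ ℕ)) (θ : MvPolynomial (Fin n) k)
    (hm : Ideal.Quotient.mk (Ideal.span {f}) (monomial m (1 : k)) ∈ Ideal.span ((fun e : Fin n →₀ ℕ => Ideal.Quotient.mk (Ideal.span {f}) (monomial e (1 : k))) '' (A : Set (Fin n →₀ ℕ))))
    (Φ : Γ(affineBlowup (Ideal.span ((fun e : Fin n →₀ ℕ => Ideal.Quotient.mk (Ideal.span {f}) (monomial e (1 : k))) '' (A : Set (Fin n →₀ ℕ)))),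
        affineBlowup.chartOpen (Ideal.Quotient.mk (Ideal.span {f}) (monomial m (1 : k))) hm) ≃+* (MvPolynomial (Fin n) k ⧸ Ideal.span {θ}))
    (hΦ : ∀ q : MvPolynomial (Fin n) k,
        Φ (affineBlowup.pull (Ideal.span ((fun e : Fin n →₀ ℕ => Ideal.Quotient.mk (Ideal.span {f}) (monomial e (1 : k))) '' (A : Set (Fin n →₀ ℕ))))
            (affineBlowup.chartOpen (Ideal.Quotient.mk (Ideal.span {f}) (monomial m (1 : k))) hm) (Ideal.Quotient.mk (Ideal.span {f}) q)) =
          Ideal.Quotient.mk (Ideal.span {θ}) (aeval (fun j : Fin n => ∏ i : Fin n, (X i : MvPolynomial (Fin n) k) ^ V i j) q))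
    (B : Finset (Fin n →₀ ℕ)) (b : Fin n →₀ ℕ) (hbB : b ∈ B)
    (hgeB : ∀ e ∈ B, (Finsupp.equivFunOnFinite.symm (V.mulVec ⇑b) : Fin n →₀ ℕ) ≤ Finsupp.equivFunOnFinite.symm (V.mulVec ⇑e))
    (g₀ : MvPolynomial (Fin n) k) (G M₁ : Fin n →₀ ℕ) (χ : MvPolynomial (Fin n) k)
    (hg₀ : aeval (fun j : Fin n => ∏ i : Fin n, (X i : MvPolynomial (Fin n) k) ^ V i j) g₀ = monomial G (1 : k) * χ)
    (hC : (Finsupp.equivFunOnFinite.symm (V.mulVec ⇑b) : Fin n →₀ ℕ) = G + M₁) :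
    ((affineBlowup.idealSheaf (Ideal.span ((fun e : Fin n →₀ ℕ => Ideal.Quotient.mk (Ideal.span {f}) (monomial e (1 : k))) '' (B : Set (Fin n →₀ ℕ))) +
        Ideal.span {Ideal.Quotient.mk (Ideal.span {f}) g₀})).comap
        (affineBlowup.π (Ideal.span ((fun e : Fin n →₀ ℕ => Ideal.Quotient.mk (Ideal.span {f}) (monomial e (1 : k))) '' (A : Set (Fin n →₀ ℕ)))))).ideal
        (affineBlowup.chartOpen (Ideal.Quotient.mk (Ideal.span {f}) (monomial m (1 : k))) hm) =
      Ideal.span {Φ.symm (Ideal.Quotient.mk (Ideal.span {θ}) (monomial G 1)) * Φ.symm (Ideal.Quotient.mk (Ideal.span {θ}) (monomial M₁ 1)),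
        Φ.symm (Ideal.Quotient.mk (Ideal.span {θ}) (monomial G 1)) * Φ.symm (Ideal.Quotient.mk (Ideal.span {θ}) χ)} := by
  have e1 : Φ.symm (Ideal.Quotient.mk (Ideal.span {θ}) (monomial G 1) * Ideal.Quotient.mk (Ideal.span {θ}) (monomial M₁ 1)) =
      Φ.symm (Ideal.Quotient.mk (Ideal.span {θ}) (monomial G 1)) * Φ.symm (Ideal.Quotient.mk (Ideal.span {θ}) (monomial M₁ 1)) := map_mul _ _ _
  have e2 : Φ.symm (Ideal.Quotient.mk (Ideal.span {θ}) (monomial G 1) * Ideal.Quotient.mk (Ideal.span {θ}) χ) =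
      Φ.symm (Ideal.Quotient.mk (Ideal.span {θ}) (monomial G 1)) * Φ.symm (Ideal.Quotient.mk (Ideal.span {θ}) χ) := map_mul _ _ _
  rw [PencilChartPackage.centre_eq_map, MonomialChartSections.ideal_comap_chartOpen_eq_comap f V m A θ hm Φ hΦ, PencilChartPackage.map_centre_eq V b B hbB hgeB θ g₀ G M₁ χ hg₀ hC,
    RingEquiv.toRingHom_eq_coe, Ideal.comap_coe, ← Ideal.map_symm, Ideal.map_span, Set.image_pair, ← e1, ← e2]

end Summit.ResolutionOfSingularities.ResolutionOfSingularities.Theorems.FInjectiveMacaulayfication.OmegaOneS2PencilCharts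

end
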